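import Literature.ComputerArithmetic.BlanchardHighamLopezMaryPranesh2020.BlockFMA
import Mathlib.Analysis.Real.Sqrt

/-!
# Fasi–Higham–Lopez–Mary–Mikaitis 2023: matrix multiplication in multiword arithmetic —
# the `p`-word splitting (2.2), the error of all `p²` word products (2.3)–(2.4),
# Algorithm 2.1 and Theorem 2.1 (2.5)–(2.6), Table 2.1, and the FABsum variants of §4.4

HONEST FRAMING (ENGINES group, engine `quad`, part QUAD-4 — batched evaluation / code-generation
kernels / profiler): shared numerical engines serving client cells; rigour lives in the verifiers;
every published number belongs to a client cell's ledger, not to the engines group. This file types,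
at MODEL LEVEL (a linearly ordered field `K`; the low precision enters only through the relative-error
model `fl_low(x) = x(1 + δ)`, `|δ| ≤ u_low`, the high precision only through constants `γ^{high}_k`),
the rounding error analysis of MULTIWORD MATRIX MULTIPLICATION: a matrix stored in precision `u_high`
is split into `p` words of precision `u_low`, `A_i = fl_low(A − Σ_{k<i} A_k)` (2.2), so that
`|A − Σ_i A_i| ≤ u_low^p |A|` and `|A_i| ≤ u_low^{i−1}(1 + u_low)|A|`; the `p²` products `A_iB_j` are
computed by a mixed-precision block FMA whose output satisfies `|Ĉ − C| ≤ γ^{high}_n |A||B|` (2.1) and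
summed in precision `u_high`, giving (2.3); Algorithm 2.1 drops the products with `i + j > p + 1`,
whose magnitude is `O(u_low^{i+j−2})` by (2.4), and Theorem 2.1 bounds its error by (2.5), to first
order `((p + 1)u_low^p + γ^{high}_{n+p²−1})|A||B|` (2.6). §4.4 replaces the evaluation of the leading
product `A₁B₁` by FABsum [BlanchardHighamMary2020, Alg. 3.1] with fp32 (v1) or fp64 (v2) inter-block
sums.

SOURCE. M. Fasi, N. J. Higham, F. Lopez, T. Mary, M. Mikaitis, *Matrix Multiplication in Multiword
Arithmetic: Error Analysis and Application to GPU Tensor Cores*, SIAM J. Sci. Comput. 45(1) (2023)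
C1–C19, doi 10.1137/21m1465032 [cite: FasiEtAl2023]; read in the accepted authors' version MIMS
EPrint 2022.3 (26 January 2022), whose section, equation, algorithm and table numbers the tags use
(PDF pages of that version: p. 4 = §2 model, (2.1), the two-word displays; p. 5 = (2.2), the `u_low^p`
displays, (2.3); p. 6 = (2.4), the truncation display, Theorem 2.1 (2.5)–(2.6); p. 7 = Algorithm 2.1,
Table 2.1; pp. 13–14 = §4.4, Algorithms 4.2–4.4 and the `2²²` remark). In our text copy the FIRST LINE
of display (2.5) is typographically damaged; `theorem21` states the bound that the printed derivation
(the paragraph between (2.4) and Theorem 2.1) yields, with both index sums kept explicit and in closed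
form, and `theorem21_firstOrder` is its legible second line (2.6) with an explicit remainder — no
character-level fidelity to the first line of (2.5) is claimed. Reference [4] of the paper is
Blanchard–Higham–Lopez–Mary–Pranesh 2020 (hypothesis (2.1) = its Theorem 3.2 with `u = 0`, `u_FMA =
u_high`, imported as the module `BlockFMA`), [6] is Blanchard–Higham–Mary 2020 (`FABsum`,
`theorem31_isBackwardSum`) [cite: BlanchardHighamMary2020], [17] is Higham, *Accuracy and Stability of
Numerical Algorithms* [cite: Higham2002ASNA] (`γ_k = ku/(1 − ku)` is `Higham2002.gamma`; its Lemma 3.3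
`γ_j + γ_k + γ_jγ_k ≤ γ_{j+k}` is proved here as `gamma_add_gamma_add_mul_le`).

DICTIONARY (paper ↦ this file).
* `fl_low`, `u_low`, "∆₁ with |∆₁| ≤ u_low" ↦ any `fl : K → K` with `RoundsRel u fl` (`∀ x, ∃ δ, |δ| ≤ u
  ∧ fl x = x(1 + δ)`): a pure relative-error model (no underflow, no subnormal terms), exactly the
  property the §2 derivation uses; `u_high` ↦ `uh`, entering only through `gamma uh k`; "we assume
  `ku < 1`" ↦ the hypotheses `((k : ℕ) : K) * uh < 1`.
* Words are 0-INDEXED: `A_{i+1} ↦ word fl a i`, the residual `A − Σ_{k≤i} A_k ↦ resid fl a (i+1)`;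
  `u_low^{i+j−2}` of (2.4) ↦ `u ^ (s + t)`; the test "`i + j ≤ p + 1`" of Algorithm 2.1 line 7 ↦
  `s + t < p` (`pairsKept p`), its complement ↦ `pairsDropped p`; all `p²` pairs ↦ `pairsAll p =
  range p ×ˢ range p`; `Σ_{i=1}^{p−1}(p − i)u_low^{p+i−1}` ↦ `droppedWeight p u = Σ_{k<p−1}(p−1−k)u^{p+k}`
  (`droppedWeight_eq`), and the weight of the kept pairs `Σ_{k<p}(k+1)u^k` ↦ `keptWeight p u`
  (`keptWeight_eq`).
* Matrices ↦ ENTRIES: a row `a = A i ·` and a column `b = B · j` over the inner index `l < n`;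
  `(AB)_{ij} ↦ dotp n a b`, `(|A||B|)_{ij} ↦ adotp n a b`, `(A_sB_t)_{ij} ↦ wdot fl n a b (s,t)`,
  `(|A_s||B_t|)_{ij} ↦ wabs fl n a b (s,t)`; the computed product of `A_s`, `B_t` ↦ a value `G (s,t)`
  with hypothesis (2.1) `|G st − wdot st| ≤ γ^{high}_n · wabs st`; "the sum of the products is evaluated
  in precision `u_high`" ↦ `C = Σ_{st} G st (1 + Θ st)` with `|Θ st| ≤ γ^{high}_{p²−1}` (any order;
  [17, (4.4)]); `n + p² − 1 ↦ n + (p*p − 1)` (equal for `p ≥ 1`). `theorem21_matrix` re-quantifies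
  the entry statement over row and column types `ι`, `ρ`.
* §4.4: blocks `c ∈ t` with position sets `sk c`, block sums `ŝ c`, total `T`, in the `IsBackwardSum`
  packaging of `FABsum.lean`; fp32/fp64 unit roundoffs ↦ `v`, `w`.

TYPED AND PROVED: the splitting calculus of (2.2) — `resid_eq_sub_sum`, `word_eq`, the exact
decomposition `Σ_{k<p} x_k + resid p = x`, `|resid i| ≤ u^i|x|`, `|x_i| ≤ u^i(1+u)|x|`, the relative
form `Σ x_k = x(1 + δ)`, `|δ| ≤ u^p`, and the two-word identities `A₁ + A₂ = A − ∆₁∆₂A`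
(`two_word`); (2.4) (`eq24`, `wabs_le`); [17, Lem. 3.3] (`gamma_add_gamma_add_mul_le`); the index
sets with `kept ∪ dropped = all`, the fibres of `s + t`, the closed forms of both weights, their sum
`(Σ_{s<p}u^s)²` and `#kept = p(p+1)/2` (`card_pairsKept`); the expansion
`AB = Σ_{s,t}A_sB_t + AΔB + ΔA·B − ΔAΔB` (`dotp_expansion`) and `|AΔB + ΔA·B − ΔAΔB| ≤ (2u^p +
u^{2p})|A||B|`; the accumulation step `γ_n + γ_N + γ_nγ_N ≤ γ_{n+N}` over any set of computed products
(`acc_bound`); EQ. (2.3) (`eq23`); the truncation bound `(1+u)²·droppedWeight·|A||B|`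
(`abs_sum_dropped_le`); THEOREM 2.1 in three forms — `theorem21_core` (kept `Σ|A_s||B_t|` explicit),
`theorem21` = (2.5) in `|A||B|` form, `theorem21_firstOrder` = (2.6) with the explicit remainder
`(7p − 6)u^{p+1} + 16γu` for `u_low ≤ 1/2` (these two constants are this file's, the print has
`O(u_{p+1} + γu_low)`), and `theorem21_matrix`; the `p = 2, 3` weights and the arithmetic of the five
rows of Table 2.1 (`weights_two`, `weights_three`, `table21`); §4.4: FABsum-v1 `γ_b + γ_m + γ_bγ_m ≤
γ_{b+m}` ("`(b + n/b) × 2⁻²⁴`") and FABsum-v2 `γ^{(32)}_b + γ^{(64)}_m + γγ` ("`b × 2⁻²⁴ + n/b × 2⁻⁵³`")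
as instances of [6, Thm. 3.1], and the `2²²` threshold `n·2⁻¹¹ ≤ √n ↔ n ≤ 2²²` (`crossTerm_threshold`,
over `ℝ`).
NOT TYPED: Algorithms 2.1, 4.1–4.4 as programs on concrete formats (binary16/bfloat16/binary32 data,
cuBLAS / CUTLASS calls) — only the model-level statements above; the claim that (2.1) holds for a
specific device (it is the hypothesis `hG`; for NVIDIA tensor cores it is [4, Thm. 3.2]); the exact
first line of display (2.5) (see SOURCE); the probabilistic `√n` refinements and the round-toward-zero
discussion of §4.3; §3 (implementation), all experiments, figures and timings of §4, Table 4.1; §5.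
DEDUP: nearest in-tree statements are `BlanchardHighamLopezMaryPranesh2020/BlockFMA.lean`
(`theorem32`: one block-FMA product with conversion error `(1 + u_low)²`, i.e. hypothesis (2.1) and the
`p = 1` case) and `UchinoOzakiImamura2025/IntegerOzakiScheme.lean` (ERROR-FREE integer slicing with a
triangular set of kept slice products, `truncation_bound`); neither has the rounded (non-error-free)
`p`-word splitting (2.2) under the relative-error model, (2.3), (2.4) or Theorem 2.1 (2.5)–(2.6), which
are new statements here; `gamma`, `IsBackwardSum` and [6, Thm. 3.1] are imported, not restated.
-/

namespace Literature.ComputerArithmetic.FasiHighamLopezMaryMikaitis2023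

open Finset Literature.ComputerArithmetic.Higham2002
open Literature.ComputerArithmetic.BlanchardHighamMary2020 (IsBackwardSum theorem31_isBackwardSum)

variable {K : Type*} [Field K] [LinearOrder K] [IsStrictOrderedRing K]

/-! ## §2, the rounding model: `fl_low(x) = x(1 + δ)`, `|δ| ≤ u_low` -/

/-- The only property of rounding to the low precision used in §2: `fl x = x(1 + δ)` with
`|δ| ≤ u` for EVERY `x` (relative-error model of `fl_low`, no underflow/overflow; `u = u_low`).
[cite: FasiEtAl2023, §2 (display after (2.1))] -/
def RoundsRel (u : K) (fl : K → K) : Prop := ∀ x, ∃ δ : K, |δ| ≤ u ∧ fl x = x * (1 + δ)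

namespace RoundsRel

variable {u : K} {fl : K → K}

/-- `|fl x − x| ≤ u|x|`. [cite: FasiEtAl2023, §2 (display after (2.1))] -/
theorem abs_sub_le (h : RoundsRel u fl) (x : K) : |fl x - x| ≤ u * |x| := by
  obtain ⟨δ, hδ, hx⟩ := h x
  rw [hx, show x * (1 + δ) - x = δ * x by ring, abs_mul]
  exact mul_le_mul_of_nonneg_right hδ (abs_nonneg x)

/-- `|fl x| ≤ (1 + u)|x|`. [cite: FasiEtAl2023, §2 (display before (2.4))] -/
theorem abs_le (h : RoundsRel u fl) (x : K) : |fl x| ≤ (1 + u) * |x| := by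
  have h1 := h.abs_sub_le x
  have h2 : |fl x| ≤ |fl x - x| + |x| := by
    have := abs_add_le (fl x - x) x
    rwa [sub_add_cancel] at this
  linarith

omit [IsStrictOrderedRing K] in
/-- `fl 0 = 0`. [cite: FasiEtAl2023, §2 (display after (2.1))] -/
theorem map_zero (h : RoundsRel u fl) : fl 0 = 0 := by
  obtain ⟨δ, -, h0⟩ := h 0
  simpa using h0

end RoundsRel

/-! ## §2, eq. (2.2): the `p`-word splitting `x = x₀ + x₁ + ⋯ + x_{p−1} + Δ` -/

/-- The residual after `i` words: `resid 0 = x`, `resid (i+1) = resid i − fl (resid i)`; this is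
`A − Σ_{k<i} A_k` of (2.2) (0-indexed words). [cite: FasiEtAl2023, §2 eq. (2.2)] -/
def resid (fl : K → K) (x : K) : ℕ → K
  | 0 => x
  | i + 1 => resid fl x i - fl (resid fl x i)

/-- The `i`-th word (0-indexed): `x_i = fl_low(x − Σ_{k<i} x_k)`, eq. (2.2) with `A_{i+1} ↦ word i`.
[cite: FasiEtAl2023, §2 eq. (2.2)] -/
def word (fl : K → K) (x : K) (i : ℕ) : K := fl (resid fl x i)

section defs
omit [LinearOrder K] [IsStrictOrderedRing K]

/-- `resid 0 = x`. [cite: FasiEtAl2023, §2 eq. (2.2)] -/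
@[simp] theorem resid_zero (fl : K → K) (x : K) : resid fl x 0 = x := rfl

/-- `resid (i+1) = resid i − word i`. [cite: FasiEtAl2023, §2 eq. (2.2)] -/
theorem resid_succ (fl : K → K) (x : K) (i : ℕ) :
    resid fl x (i + 1) = resid fl x i - word fl x i := rfl

/-- `resid i = x − Σ_{k<i} word k`. [cite: FasiEtAl2023, §2 eq. (2.2)] -/
theorem resid_eq_sub_sum (fl : K → K) (x : K) :
    ∀ i : ℕ, resid fl x i = x - ∑ k ∈ range i, word fl x k
  | 0 => by simp
  | i + 1 => by rw [resid_succ, resid_eq_sub_sum fl x i, sum_range_succ]; ring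

/-- EQ. (2.2) literally: `x_i = fl_low(x − Σ_{k<i} x_k)`. [cite: FasiEtAl2023, §2 eq. (2.2)] -/
theorem word_eq (fl : K → K) (x : K) (i : ℕ) :
    word fl x i = fl (x - ∑ k ∈ range i, word fl x k) := by
  rw [word, resid_eq_sub_sum]

/-- The splitting is an exact decomposition `Σ_{k<p} x_k + resid p = x`.
[cite: FasiEtAl2023, §2 (display after (2.2))] -/
theorem sum_word_add_resid (fl : K → K) (x : K) (p : ℕ) :
    ∑ k ∈ range p, word fl x k + resid fl x p = x := by
  rw [resid_eq_sub_sum]; ring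

end defs

variable {u : K} {fl : K → K}

/-- The approximation error of `i` words: `|x − Σ_{k<i} x_k| = |resid i| ≤ u^i |x|`
("|A − Σ A_i| ≤ u_low^p |A|"). [cite: FasiEtAl2023, §2 (display after (2.2))] -/
theorem abs_resid_le (h : RoundsRel u fl) (hu : 0 ≤ u) (x : K) :
    ∀ i : ℕ, |resid fl x i| ≤ u ^ i * |x|
  | 0 => by simp
  | i + 1 => by
      have ih := abs_resid_le h hu x i
      have hstep : |resid fl x (i + 1)| ≤ u * |resid fl x i| := by
        rw [resid_succ, word, abs_sub_comm]
        exact h.abs_sub_le _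
      calc |resid fl x (i + 1)| ≤ u * |resid fl x i| := hstep
        _ ≤ u * (u ^ i * |x|) := mul_le_mul_of_nonneg_left ih hu
        _ = u ^ (i + 1) * |x| := by ring

/-- The size of the words: `|x_i| ≤ u^i (1 + u) |x|` ("|A_i| ≤ u_low^{i−1}(1 + u_low)|A|", 1-indexed
in print). [cite: FasiEtAl2023, §2 (display before (2.4))] -/
theorem abs_word_le (h : RoundsRel u fl) (hu : 0 ≤ u) (x : K) (i : ℕ) :
    |word fl x i| ≤ u ^ i * (1 + u) * |x| := by
  calc |word fl x i| ≤ (1 + u) * |resid fl x i| := h.abs_le _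
    _ ≤ (1 + u) * (u ^ i * |x|) := mul_le_mul_of_nonneg_left (abs_resid_le h hu x i) (by linarith)
    _ = u ^ i * (1 + u) * |x| := by ring

/-- `|x − Σ_{k<p} x_k| ≤ u^p |x|`. [cite: FasiEtAl2023, §2 (display after (2.2))] -/
theorem abs_sub_sum_word_le (h : RoundsRel u fl) (hu : 0 ≤ u) (x : K) (p : ℕ) :
    |x - ∑ k ∈ range p, word fl x k| ≤ u ^ p * |x| := by
  rw [← resid_eq_sub_sum]; exact abs_resid_le h hu x p

/-- Relative form: `Σ_{k<p} x_k = x(1 + δ)` with `|δ| ≤ u^p` ("A₁ + A₂ = A + ΔA, |ΔA| ≤ u_low² |A|"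
for `p = 2`). [cite: FasiEtAl2023, §2 (display after (2.1))] -/
theorem exists_sum_word_eq (h : RoundsRel u fl) (hu : 0 ≤ u) (x : K) (p : ℕ) :
    ∃ δ : K, |δ| ≤ u ^ p ∧ ∑ k ∈ range p, word fl x k = x * (1 + δ) := by
  have hs : ∑ k ∈ range p, word fl x k = x - resid fl x p := by rw [resid_eq_sub_sum]; ring
  by_cases hx : x = 0
  · subst hx
    refine ⟨0, by simpa using pow_nonneg hu p, ?_⟩
    have hr := abs_resid_le h hu (0 : K) p
    rw [abs_zero, mul_zero] at hr
    rw [hs, abs_nonpos_iff.mp hr]; ring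
  · refine ⟨-(resid fl x p) / x, ?_, ?_⟩
    · rw [abs_div, abs_neg, div_le_iff₀ (abs_pos.mpr hx)]
      exact abs_resid_le h hu x p
    · rw [hs]; field_simp; ring

omit [IsStrictOrderedRing K] in
/-- The two-word case spelled out: `x₀ = x(1 + δ₁)`, `x₁ = −xδ₁(1 + δ₂)`, `x₀ + x₁ = x − xδ₁δ₂`
("A₁ + A₂ = A − ∆₁ ∘ ∆₂ ∘ A"). [cite: FasiEtAl2023, §2 (display after (2.1))] -/
theorem two_word (h : RoundsRel u fl) (x : K) :
    ∃ δ₁ δ₂ : K, |δ₁| ≤ u ∧ |δ₂| ≤ u ∧ word fl x 0 = x * (1 + δ₁) ∧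
      word fl x 1 = -(x * δ₁) * (1 + δ₂) ∧ word fl x 0 + word fl x 1 = x - x * δ₁ * δ₂ := by
  obtain ⟨δ₁, h₁, e₁⟩ := h x
  obtain ⟨δ₂, h₂, e₂⟩ := h (x - fl x)
  have w0 : word fl x 0 = fl x := rfl
  have w1 : word fl x 1 = fl (x - fl x) := rfl
  refine ⟨δ₁, δ₂, h₁, h₂, by rw [w0, e₁], ?_, ?_⟩
  · rw [w1, e₂, e₁]; ring
  · rw [w0, w1, e₂, e₁]; ring

/-- EQ. (2.4), scalar form: `|x_i||y_j| ≤ u^{i+j}(1 + u)² |x||y|` (entrywise this is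
`|A_i||B_j| ≤ u_low^{i+j−2}(1 + u_low)²|A||B|`, 1-indexed in print). [cite: FasiEtAl2023, §2 eq. (2.4)] -/
theorem eq24 (h : RoundsRel u fl) (hu : 0 ≤ u) (x y : K) (i j : ℕ) :
    |word fl x i| * |word fl y j| ≤ u ^ (i + j) * (1 + u) ^ 2 * (|x| * |y|) := by
  have hx := abs_word_le h hu x i
  have hy := abs_word_le h hu y j
  calc |word fl x i| * |word fl y j| ≤ (u ^ i * (1 + u) * |x|) * (u ^ j * (1 + u) * |y|) :=
        mul_le_mul hx hy (abs_nonneg _) (le_trans (abs_nonneg _) hx)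
    _ = u ^ (i + j) * (1 + u) ^ 2 * (|x| * |y|) := by ring

/-- `γ_n + γ_m + γ_nγ_m ≤ γ_{n+m}` [Higham2002ASNA, Lemma 3.3], the step that merges the product
constant `γ_n` of (2.1) with the accumulation constant `γ_{p²−1}` into `γ_{n+p²−1}` in (2.3).
[cite: Higham2002ASNA, Lemma 3.3] -/
theorem gamma_add_gamma_add_mul_le {v : K} (hv : 0 ≤ v) {n m : ℕ}
    (hnm : ((n + m : ℕ) : K) * v < 1) :
    gamma v n + gamma v m + gamma v n * gamma v m ≤ gamma v (n + m) := by
  have hn : (n : K) * v < 1 := by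
    have : (n : K) * v ≤ ((n + m : ℕ) : K) * v := by push_cast; nlinarith
    linarith
  have hm : (m : K) * v < 1 := by
    have : (m : K) * v ≤ ((n + m : ℕ) : K) * v := by push_cast; nlinarith
    linarith
  unfold gamma
  have h1 : 0 < 1 - (n : K) * v := by linarith
  have h2 : 0 < 1 - (m : K) * v := by linarith
  have h3 : 0 < 1 - ((n + m : ℕ) : K) * v := by linarith
  rw [div_add_div _ _ h1.ne' h2.ne', div_mul_div_comm, div_add_div _ _ (mul_pos h1 h2).ne'
    (mul_pos h1 h2).ne', div_le_div_iff₀ (mul_pos (mul_pos h1 h2) (mul_pos h1 h2)) h3]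
  push_cast
  have hnn : (0 : K) ≤ n := Nat.cast_nonneg n
  have hmn : (0 : K) ≤ m := Nat.cast_nonneg m
  nlinarith [mul_nonneg hnn hmn, mul_nonneg (mul_nonneg hnn hmn) hv, mul_pos h1 h2,
    mul_nonneg (mul_nonneg (mul_nonneg hnn hmn) hv) hv, h3.le]

/-! ## The index sets of word products: all `p²` pairs, and Algorithm 2.1's kept pairs -/

/-- All `p²` pairs `(s, t)`, `s, t < p`, of word products `A_s B_t` (eq. (2.3) sums them all).
[cite: FasiEtAl2023, §2 eq. (2.3)] -/
def pairsAll (p : ℕ) : Finset (ℕ × ℕ) := range p ×ˢ range p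

/-- The pairs KEPT by Algorithm 2.1 (line 7, "if i + j ≤ p + 1", 1-indexed): `s + t ≤ p − 1`.
[cite: FasiEtAl2023, §2 Algorithm 2.1] -/
def pairsKept (p : ℕ) : Finset (ℕ × ℕ) := (pairsAll p).filter (fun st => st.1 + st.2 < p)

/-- The pairs DROPPED by Algorithm 2.1: `s + t ≥ p` (1-indexed `i + j > p + 1`), whose products have
magnitude `O(u_low^p)` or below. [cite: FasiEtAl2023, §2 (display before (2.5))] -/
def pairsDropped (p : ℕ) : Finset (ℕ × ℕ) := (pairsAll p).filter (fun st => p ≤ st.1 + st.2)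

/-- The weight of the kept pairs, `Σ_{(s,t) kept} u^{s+t}` (multiplies `γ·(1+u)²|A||B|` in (2.5)).
[cite: FasiEtAl2023, §2 eq. (2.5)] -/
def keptWeight (p : ℕ) (u : K) : K := ∑ st ∈ pairsKept p, u ^ (st.1 + st.2)

/-- The weight of the dropped pairs, `Σ_{(s,t) dropped} u^{s+t}` (the truncation error of Algorithm 2.1
is at most `(1+u)²` times it, times `|A||B|`). [cite: FasiEtAl2023, §2 eq. (2.5)] -/
def droppedWeight (p : ℕ) (u : K) : K := ∑ st ∈ pairsDropped p, u ^ (st.1 + st.2)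

/-- Membership in `pairsAll`. [cite: FasiEtAl2023, §2 eq. (2.3)] -/
theorem mem_pairsAll {p : ℕ} {st : ℕ × ℕ} : st ∈ pairsAll p ↔ st.1 < p ∧ st.2 < p := by
  simp [pairsAll, mem_product]

/-- Membership in `pairsKept`. [cite: FasiEtAl2023, §2 Algorithm 2.1] -/
theorem mem_pairsKept {p : ℕ} {st : ℕ × ℕ} :
    st ∈ pairsKept p ↔ st.1 < p ∧ st.2 < p ∧ st.1 + st.2 < p := by
  simp [pairsKept, mem_pairsAll, and_assoc]

/-- Membership in `pairsDropped`. [cite: FasiEtAl2023, §2 (display before (2.5))] -/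
theorem mem_pairsDropped {p : ℕ} {st : ℕ × ℕ} :
    st ∈ pairsDropped p ↔ st.1 < p ∧ st.2 < p ∧ p ≤ st.1 + st.2 := by
  simp [pairsDropped, mem_pairsAll, and_assoc]

/-- Kept and dropped pairs are disjoint. [cite: FasiEtAl2023, §2 Algorithm 2.1] -/
theorem disjoint_pairsKept_pairsDropped (p : ℕ) : Disjoint (pairsKept p) (pairsDropped p) := by
  rw [Finset.disjoint_left]
  intro st h1 h2
  rw [mem_pairsKept] at h1; rw [mem_pairsDropped] at h2
  omega

/-- Kept ∪ dropped = all pairs. [cite: FasiEtAl2023, §2 Algorithm 2.1] -/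
theorem pairsKept_union_pairsDropped (p : ℕ) : pairsKept p ∪ pairsDropped p = pairsAll p := by
  ext st
  rw [mem_union, mem_pairsKept, mem_pairsDropped, mem_pairsAll]
  omega

omit [LinearOrder K] [IsStrictOrderedRing K] in
/-- A sum over all pairs splits into kept plus dropped. [cite: FasiEtAl2023, §2 Algorithm 2.1] -/
theorem sum_pairsAll_eq_add (p : ℕ) (f : ℕ × ℕ → K) :
    ∑ st ∈ pairsAll p, f st = ∑ st ∈ pairsKept p, f st + ∑ st ∈ pairsDropped p, f st := by
  rw [← pairsKept_union_pairsDropped, sum_union (disjoint_pairsKept_pairsDropped p)]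

omit [LinearOrder K] [IsStrictOrderedRing K] in
/-- A sum over all pairs as an iterated sum. [cite: FasiEtAl2023, §2 eq. (2.3)] -/
theorem sum_pairsAll (p : ℕ) (f : ℕ × ℕ → K) :
    ∑ st ∈ pairsAll p, f st = ∑ s ∈ range p, ∑ t ∈ range p, f (s, t) := by
  rw [pairsAll, sum_product]

/-- The pairs of total degree `k < p` are `(s, k − s)`, `s ≤ k` (all of them kept).
[cite: FasiEtAl2023, §2 Algorithm 2.1] -/
theorem fiber_low {p k : ℕ} (hk : k < p) :
    (pairsAll p).filter (fun st => st.1 + st.2 = k) = (range (k + 1)).image (fun s => (s, k - s)) := by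
  ext ⟨s, t⟩
  simp only [mem_filter, mem_pairsAll, mem_image, mem_range, Prod.mk.injEq]
  constructor
  · rintro ⟨⟨hs, ht⟩, hst⟩
    exact ⟨s, by omega, rfl, by omega⟩
  · rintro ⟨s', hs', rfl, rfl⟩
    omega

/-- The pairs of total degree `p + j` are `(s, p + j − s)`, `j + 1 ≤ s ≤ p − 1` (all dropped).
[cite: FasiEtAl2023, §2 (display before (2.5))] -/
theorem fiber_high (p j : ℕ) :
    (pairsAll p).filter (fun st => st.1 + st.2 = p + j)
      = (Ico (j + 1) p).image (fun s => (s, p + j - s)) := by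
  ext ⟨s, t⟩
  simp only [mem_filter, mem_pairsAll, mem_image, mem_Ico, Prod.mk.injEq]
  constructor
  · rintro ⟨⟨hs, ht⟩, hst⟩
    exact ⟨s, ⟨by omega, hs⟩, rfl, by omega⟩
  · rintro ⟨s', ⟨hs1, hs2⟩, rfl, rfl⟩
    omega

/-- `k + 1` pairs of total degree `k < p`. [cite: FasiEtAl2023, §2 Algorithm 2.1] -/
theorem card_fiber_low {p k : ℕ} (hk : k < p) :
    ((pairsAll p).filter (fun st => st.1 + st.2 = k)).card = k + 1 := by
  rw [fiber_low hk, card_image_of_injective _ (fun a b h => (Prod.mk.inj h).1), card_range]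

/-- `p − 1 − j` pairs of total degree `p + j`. [cite: FasiEtAl2023, §2 (display before (2.5))] -/
theorem card_fiber_high (p j : ℕ) :
    ((pairsAll p).filter (fun st => st.1 + st.2 = p + j)).card = p - 1 - j := by
  rw [fiber_high, card_image_of_injective _ (fun a b h => (Prod.mk.inj h).1), Nat.card_Ico]
  omega

omit [LinearOrder K] [IsStrictOrderedRing K] in
/-- Closed form of the kept weight: `Σ_{(s,t) kept} u^{s+t} = Σ_{k<p} (k+1) u^k`
(`= 1 + 2u + 3u² + ⋯ + p u^{p−1}`). [cite: FasiEtAl2023, §2 eq. (2.5)] -/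
theorem keptWeight_eq (p : ℕ) (u : K) : keptWeight p u = ∑ k ∈ range p, ((k : K) + 1) * u ^ k := by
  unfold keptWeight
  have hmaps : ∀ st ∈ pairsKept p, st.1 + st.2 ∈ range p := by
    intro st hst; rw [mem_pairsKept] at hst; rw [mem_range]; exact hst.2.2
  rw [← sum_fiberwise_of_maps_to hmaps]
  refine sum_congr rfl fun k hk => ?_
  rw [mem_range] at hk
  have hfib : (pairsKept p).filter (fun st => st.1 + st.2 = k)
      = (pairsAll p).filter (fun st => st.1 + st.2 = k) := by
    ext st
    simp only [mem_filter, mem_pairsKept, mem_pairsAll]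
    constructor
    · rintro ⟨⟨h1, h2, _⟩, h4⟩; exact ⟨⟨h1, h2⟩, h4⟩
    · rintro ⟨⟨h1, h2⟩, h4⟩; exact ⟨⟨h1, h2, by omega⟩, h4⟩
  rw [hfib]
  have : ∑ st ∈ (pairsAll p).filter (fun st => st.1 + st.2 = k), u ^ (st.1 + st.2)
      = ∑ st ∈ (pairsAll p).filter (fun st => st.1 + st.2 = k), u ^ k := by
    refine sum_congr rfl fun st hst => ?_
    rw [mem_filter] at hst; rw [hst.2]
  rw [this, sum_const, card_fiber_low hk, nsmul_eq_mul]
  push_cast; ring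

omit [LinearOrder K] [IsStrictOrderedRing K] in
/-- Closed form of the dropped weight: `Σ_{(s,t) dropped} u^{s+t} = Σ_{k<p−1} (p−1−k) u^{p+k}`, i.e. the
print's `Σ_{i=1}^{p−1} (p − i) u_low^{p+i−1}` (`i = k + 1`). [cite: FasiEtAl2023, §2 eq. (2.5)] -/
theorem droppedWeight_eq (p : ℕ) (u : K) :
    droppedWeight p u = ∑ k ∈ range (p - 1), ((p - 1 - k : ℕ) : K) * u ^ (p + k) := by
  unfold droppedWeight
  have hmaps : ∀ st ∈ pairsDropped p, st.1 + st.2 ∈ Ico p (p + (p - 1)) := by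
    intro st hst; rw [mem_pairsDropped] at hst; rw [mem_Ico]; omega
  rw [← sum_fiberwise_of_maps_to hmaps, sum_Ico_eq_sum_range]
  simp only [add_tsub_cancel_left]
  refine sum_congr rfl fun j _ => ?_
  have hfib : (pairsDropped p).filter (fun st => st.1 + st.2 = p + j)
      = (pairsAll p).filter (fun st => st.1 + st.2 = p + j) := by
    ext st
    simp only [mem_filter, mem_pairsDropped, mem_pairsAll]
    constructor
    · rintro ⟨⟨h1, h2, _⟩, h4⟩; exact ⟨⟨h1, h2⟩, h4⟩
    · rintro ⟨⟨h1, h2⟩, h4⟩; exact ⟨⟨h1, h2, by omega⟩, h4⟩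
  rw [hfib]
  have : ∑ st ∈ (pairsAll p).filter (fun st => st.1 + st.2 = p + j), u ^ (st.1 + st.2)
      = ∑ st ∈ (pairsAll p).filter (fun st => st.1 + st.2 = p + j), u ^ (p + j) := by
    refine sum_congr rfl fun st hst => ?_
    rw [mem_filter] at hst; rw [hst.2]
  rw [this, sum_const, card_fiber_high, nsmul_eq_mul]

omit [LinearOrder K] [IsStrictOrderedRing K] in
/-- All pairs weigh `(Σ_{s<p} u^s)²`. [cite: FasiEtAl2023, §2 eq. (2.3)] -/
theorem sum_pairsAll_pow (p : ℕ) (u : K) :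
    ∑ st ∈ pairsAll p, u ^ (st.1 + st.2) = (∑ s ∈ range p, u ^ s) ^ 2 := by
  rw [sum_pairsAll, sq, sum_mul_sum]
  refine sum_congr rfl fun s _ => sum_congr rfl fun t _ => by rw [pow_add]

omit [LinearOrder K] [IsStrictOrderedRing K] in
/-- Kept weight + dropped weight = `(Σ_{s<p} u^s)²`. [cite: FasiEtAl2023, §2 eq. (2.5)] -/
theorem keptWeight_add_droppedWeight (p : ℕ) (u : K) :
    keptWeight p u + droppedWeight p u = (∑ s ∈ range p, u ^ s) ^ 2 := by
  rw [keptWeight, droppedWeight, ← sum_pairsAll_eq_add, sum_pairsAll_pow]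

/-- Algorithm 2.1 computes `p(p+1)/2` of the `p²` products ("the number of products is reduced from
`p²` to `p(p+1)/2`"). [cite: FasiEtAl2023, §2 (sentence after Algorithm 2.1)] -/
theorem card_pairsKept (p : ℕ) : (pairsKept p).card * 2 = p * (p + 1) := by
  have h := keptWeight_eq p (1 : ℚ)
  simp only [keptWeight, one_pow, sum_const, nsmul_eq_mul, mul_one] at h
  have key : ∀ q : ℕ, (∑ x ∈ range q, ((x : ℚ) + 1)) * 2 = q * (q + 1) := by
    intro q
    induction q with
    | zero => simp
    | succ q ih => rw [sum_range_succ, add_mul, ih]; push_cast; ring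
  have h2 : ((pairsKept p).card : ℚ) * 2 = p * (p + 1) := by rw [h, key]
  exact_mod_cast h2

/-! ## §2, eqs. (2.3)–(2.4): the error in the `(i, j)` entry of a multiword product

Throughout, `a l = A i l` and `b l = B l j` (`l < n`) are a row of `A` and a column of `B`;
`u = u_low`, `uh = u_high`. -/

section products

variable {uh : K}

/-- The exact `(s, t)` word product entry `(A_s B_t)_{ij} = Σ_{l<n} a_{l,s} b_{l,t}`.
[cite: FasiEtAl2023, §2 eq. (2.3)] -/
def wdot (fl : K → K) (n : ℕ) (a b : ℕ → K) (st : ℕ × ℕ) : K :=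
  ∑ l ∈ range n, word fl (a l) st.1 * word fl (b l) st.2

/-- The entry `(|A_s||B_t|)_{ij} = Σ_{l<n} |a_{l,s}||b_{l,t}|`, the scale of hypothesis (2.1) for the
product `A_s B_t`. [cite: FasiEtAl2023, §2 eq. (2.1)] -/
def wabs (fl : K → K) (n : ℕ) (a b : ℕ → K) (st : ℕ × ℕ) : K :=
  ∑ l ∈ range n, |word fl (a l) st.1| * |word fl (b l) st.2|

omit [LinearOrder K] [IsStrictOrderedRing K] in
/-- The exact entry `(AB)_{ij} = Σ_{l<n} a_l b_l`. [cite: FasiEtAl2023, §2 eq. (2.3)] -/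
def dotp (n : ℕ) (a b : ℕ → K) : K := ∑ l ∈ range n, a l * b l

/-- The entry `(|A||B|)_{ij} = Σ_{l<n} |a_l||b_l|`. [cite: FasiEtAl2023, §2 eq. (2.3)] -/
def adotp (n : ℕ) (a b : ℕ → K) : K := ∑ l ∈ range n, |a l| * |b l|

/-- `|(A_s B_t)_{ij}| ≤ (|A_s||B_t|)_{ij}`. [cite: FasiEtAl2023, §2 eq. (2.1)] -/
theorem abs_wdot_le_wabs (fl : K → K) (n : ℕ) (a b : ℕ → K) (st : ℕ × ℕ) :
    |wdot fl n a b st| ≤ wabs fl n a b st :=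
  (abs_sum_le_sum_abs _ _).trans (le_of_eq (sum_congr rfl fun _ _ => abs_mul _ _))

/-- `(|A||B|)_{ij} ≥ 0`. [cite: FasiEtAl2023, §2 eq. (2.3)] -/
theorem adotp_nonneg (n : ℕ) (a b : ℕ → K) : 0 ≤ adotp n a b :=
  sum_nonneg fun _ _ => mul_nonneg (abs_nonneg _) (abs_nonneg _)

/-- EQ. (2.4) entrywise: `(|A_s||B_t|)_{ij} ≤ u^{s+t}(1+u)² (|A||B|)_{ij}`.
[cite: FasiEtAl2023, §2 eq. (2.4)] -/
theorem wabs_le (h : RoundsRel u fl) (hu : 0 ≤ u) (n : ℕ) (a b : ℕ → K) (st : ℕ × ℕ) :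
    wabs fl n a b st ≤ u ^ (st.1 + st.2) * (1 + u) ^ 2 * adotp n a b := by
  unfold wabs adotp; rw [mul_sum]; exact sum_le_sum fun _ _ => eq24 h hu _ _ _ _

omit [LinearOrder K] [IsStrictOrderedRing K] in
/-- The algebra behind (2.3): with `ΔA = resid p` (so `Σ_s A_s = A − ΔA`),
`AB = Σ_{s,t} A_s B_t + (A·ΔB + ΔA·B − ΔA·ΔB)` entrywise ("C = Σ A_iB_j + AΔB + ΔAB − ΔAΔB").
[cite: FasiEtAl2023, §2 (derivation of (2.3))] -/
theorem dotp_expansion (fl : K → K) (n p : ℕ) (a b : ℕ → K) :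
    dotp n a b = ∑ st ∈ pairsAll p, wdot fl n a b st
      + ∑ l ∈ range n, (a l * resid fl (b l) p + resid fl (a l) p * b l
          - resid fl (a l) p * resid fl (b l) p) := by
  have key : ∀ l, a l * b l = (∑ s ∈ range p, ∑ t ∈ range p, word fl (a l) s * word fl (b l) t)
      + (a l * resid fl (b l) p + resid fl (a l) p * b l - resid fl (a l) p * resid fl (b l) p) := by
    intro l
    rw [← sum_mul_sum,
      show ∑ s ∈ range p, word fl (a l) s = a l - resid fl (a l) p by rw [resid_eq_sub_sum]; ring,
      show ∑ t ∈ range p, word fl (b l) t = b l - resid fl (b l) p by rw [resid_eq_sub_sum]; ring]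
    ring
  unfold dotp wdot
  calc ∑ l ∈ range n, a l * b l
      = ∑ l ∈ range n, ((∑ s ∈ range p, ∑ t ∈ range p, word fl (a l) s * word fl (b l) t)
          + (a l * resid fl (b l) p + resid fl (a l) p * b l
              - resid fl (a l) p * resid fl (b l) p)) := sum_congr rfl fun l _ => key l
    _ = (∑ l ∈ range n, ∑ s ∈ range p, ∑ t ∈ range p, word fl (a l) s * word fl (b l) t)
          + ∑ l ∈ range n, (a l * resid fl (b l) p + resid fl (a l) p * b l
              - resid fl (a l) p * resid fl (b l) p) := sum_add_distrib
    _ = _ := by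
        congr 1
        rw [sum_pairsAll]
        calc ∑ l ∈ range n, ∑ s ∈ range p, ∑ t ∈ range p, word fl (a l) s * word fl (b l) t
            = ∑ s ∈ range p, ∑ l ∈ range n, ∑ t ∈ range p, word fl (a l) s * word fl (b l) t :=
              sum_comm
          _ = ∑ s ∈ range p, ∑ t ∈ range p, ∑ l ∈ range n, word fl (a l) s * word fl (b l) t :=
              sum_congr rfl fun s _ => sum_comm

/-- The conversion terms of (2.3): `|aΔb + Δa·b − ΔaΔb| ≤ (2u^p + u^{2p})|a||b|`
("|ΔA| ≤ u_low^p |A|, |ΔB| ≤ u_low^p |B|"). [cite: FasiEtAl2023, §2 (derivation of (2.3))] -/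
theorem abs_conv_le (h : RoundsRel u fl) (hu : 0 ≤ u) (x y : K) (p : ℕ) :
    |x * resid fl y p + resid fl x p * y - resid fl x p * resid fl y p|
      ≤ (2 * u ^ p + u ^ (2 * p)) * (|x| * |y|) := by
  have hx := abs_resid_le h hu x p
  have hy := abs_resid_le h hu y p
  have hup : 0 ≤ u ^ p := pow_nonneg hu p
  have t1 : |x * resid fl y p| ≤ u ^ p * (|x| * |y|) := by
    rw [abs_mul]
    calc |x| * |resid fl y p| ≤ |x| * (u ^ p * |y|) := mul_le_mul_of_nonneg_left hy (abs_nonneg _)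
      _ = u ^ p * (|x| * |y|) := by ring
  have t2 : |resid fl x p * y| ≤ u ^ p * (|x| * |y|) := by
    rw [abs_mul]
    calc |resid fl x p| * |y| ≤ (u ^ p * |x|) * |y| := mul_le_mul_of_nonneg_right hx (abs_nonneg _)
      _ = u ^ p * (|x| * |y|) := by ring
  have t3 : |resid fl x p * resid fl y p| ≤ u ^ (2 * p) * (|x| * |y|) := by
    rw [abs_mul]
    calc |resid fl x p| * |resid fl y p| ≤ (u ^ p * |x|) * (u ^ p * |y|) :=
          mul_le_mul hx hy (abs_nonneg _) (mul_nonneg hup (abs_nonneg _))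
      _ = u ^ (2 * p) * (|x| * |y|) := by ring
  calc |x * resid fl y p + resid fl x p * y - resid fl x p * resid fl y p|
      ≤ |x * resid fl y p + resid fl x p * y| + |resid fl x p * resid fl y p| := by
        simpa [sub_eq_add_neg, abs_neg] using
          abs_add_le (x * resid fl y p + resid fl x p * y) (-(resid fl x p * resid fl y p))
    _ ≤ |x * resid fl y p| + |resid fl x p * y| + |resid fl x p * resid fl y p| := by
        linarith [abs_add_le (x * resid fl y p) (resid fl x p * y)]
    _ ≤ _ := by linarith

/-- The accumulation step behind (2.3)/(2.5): if each computed product `Ĝ_{st}` satisfies (2.1),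
`|Ĝ_{st} − G_{st}| ≤ γ^{high}_n X_{st}` with `|G_{st}| ≤ X_{st}`, and the products are summed in
precision `u_high` with relative perturbations `|Θ_{st}| ≤ γ^{high}_N`, then
`|Σ Ĝ_{st}(1 + Θ_{st}) − Σ G_{st}| ≤ γ^{high}_{n+N} Σ X_{st}` (by `γ_n + γ_N + γ_nγ_N ≤ γ_{n+N}`).
[cite: FasiEtAl2023, §2 (derivation of (2.3))] -/
theorem acc_bound {S : Finset (ℕ × ℕ)} (huh : 0 ≤ uh) {n N : ℕ}
    (hN : ((n + N : ℕ) : K) * uh < 1) {G Θ E X : ℕ × ℕ → K}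
    (hG : ∀ st ∈ S, |G st - E st| ≤ gamma uh n * X st)
    (hΘ : ∀ st ∈ S, |Θ st| ≤ gamma uh N) (hEX : ∀ st ∈ S, |E st| ≤ X st) :
    |∑ st ∈ S, G st * (1 + Θ st) - ∑ st ∈ S, E st| ≤ gamma uh (n + N) * ∑ st ∈ S, X st := by
  have hcomb := gamma_add_gamma_add_mul_le huh hN
  have hn : (n : K) * uh < 1 := by
    have : (n : K) * uh ≤ ((n + N : ℕ) : K) * uh := by push_cast; nlinarith
    linarith
  have hgn : 0 ≤ gamma uh n := gamma_nonneg huh hn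
  rw [← sum_sub_distrib, mul_sum]
  refine (abs_sum_le_sum_abs _ _).trans (sum_le_sum fun st hst => ?_)
  have hX : 0 ≤ X st := (abs_nonneg _).trans (hEX st hst)
  have e : G st * (1 + Θ st) - E st = (G st - E st) * (1 + Θ st) + E st * Θ st := by ring
  have h1Θ : |1 + Θ st| ≤ 1 + gamma uh N := by
    calc |1 + Θ st| ≤ |(1 : K)| + |Θ st| := abs_add_le _ _
      _ ≤ 1 + gamma uh N := by rw [abs_one]; linarith [hΘ st hst]
  rw [e]
  calc |(G st - E st) * (1 + Θ st) + E st * Θ st|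
      ≤ |(G st - E st) * (1 + Θ st)| + |E st * Θ st| := abs_add_le _ _
    _ = |G st - E st| * |1 + Θ st| + |E st| * |Θ st| := by rw [abs_mul, abs_mul]
    _ ≤ gamma uh n * X st * (1 + gamma uh N) + X st * gamma uh N :=
        add_le_add (mul_le_mul (hG st hst) h1Θ (abs_nonneg _) (mul_nonneg hgn hX))
          (mul_le_mul (hEX st hst) (hΘ st hst) (abs_nonneg _) hX)
    _ = (gamma uh n + gamma uh N + gamma uh n * gamma uh N) * X st := by ring
    _ ≤ gamma uh (n + N) * X st := mul_le_mul_of_nonneg_right hcomb hX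

/-- EQ. (2.3) (all `p²` products, at the `(i, j)` entry). Hypotheses: every word product
`Ĝ_{st} ≈ (A_s B_t)_{ij}` satisfies (2.1) with `γ^{high}_n`, and `Ĉ_{ij} = Σ_{s,t} Ĝ_{st}(1 + Θ_{st})` is
their sum evaluated in precision `u_high`, `|Θ_{st}| ≤ γ^{high}_{p²−1}`. Conclusion:
`|Ĉ − AB|_{ij} ≤ (2u_low^p + u_low^{2p})(|A||B|)_{ij} + γ^{high}_{n+p²−1} Σ_{s,t} (|A_s||B_t|)_{ij}`
(`n + (p*p − 1) = n + p² − 1` for `p ≥ 1`). [cite: FasiEtAl2023, §2 eq. (2.3)] -/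
theorem eq23 (h : RoundsRel u fl) (hu : 0 ≤ u) (huh : 0 ≤ uh) {n p : ℕ}
    (hN : ((n + (p * p - 1) : ℕ) : K) * uh < 1) (a b : ℕ → K) {G Θ : ℕ × ℕ → K} {C : K}
    (hG : ∀ st ∈ pairsAll p, |G st - wdot fl n a b st| ≤ gamma uh n * wabs fl n a b st)
    (hΘ : ∀ st ∈ pairsAll p, |Θ st| ≤ gamma uh (p * p - 1))
    (hC : C = ∑ st ∈ pairsAll p, G st * (1 + Θ st)) :
    |C - dotp n a b| ≤ (2 * u ^ p + u ^ (2 * p)) * adotp n a b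
      + gamma uh (n + (p * p - 1)) * ∑ st ∈ pairsAll p, wabs fl n a b st := by
  have hacc := acc_bound huh hN hG hΘ (fun st _ => abs_wdot_le_wabs fl n a b st)
  have hconv : |∑ l ∈ range n, (a l * resid fl (b l) p + resid fl (a l) p * b l
      - resid fl (a l) p * resid fl (b l) p)| ≤ (2 * u ^ p + u ^ (2 * p)) * adotp n a b := by
    unfold adotp; rw [mul_sum]
    exact (abs_sum_le_sum_abs _ _).trans (sum_le_sum fun _ _ => abs_conv_le h hu _ _ _)
  rw [hC, dotp_expansion fl n p a b]
  set A := ∑ st ∈ pairsAll p, G st * (1 + Θ st)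
  set S := ∑ st ∈ pairsAll p, wdot fl n a b st
  set V := ∑ l ∈ range n, (a l * resid fl (b l) p + resid fl (a l) p * b l
      - resid fl (a l) p * resid fl (b l) p)
  have e : A - (S + V) = (A - S) + (-V) := by ring
  rw [e]
  calc |(A - S) + (-V)| ≤ |A - S| + |-V| := abs_add_le _ _
    _ = |A - S| + |V| := by rw [abs_neg]
    _ ≤ _ := by linarith

/-- The truncation error of Algorithm 2.1 at the `(i, j)` entry: the dropped products satisfy
`|Σ_{(s,t) dropped} (A_s B_t)_{ij}| ≤ (1 + u)² · (Σ_{dropped} u^{s+t}) · (|A||B|)_{ij}`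
(from (2.4); "p − i multiplicands of order u_low^{p+i−1}|A||B|").
[cite: FasiEtAl2023, §2 (display before (2.5))] -/
theorem abs_sum_dropped_le (h : RoundsRel u fl) (hu : 0 ≤ u) (n p : ℕ) (a b : ℕ → K) :
    |∑ st ∈ pairsDropped p, wdot fl n a b st| ≤ (1 + u) ^ 2 * droppedWeight p u * adotp n a b := by
  unfold droppedWeight; rw [mul_sum, sum_mul]
  refine (abs_sum_le_sum_abs _ _).trans (sum_le_sum fun st _ => ?_)
  calc |wdot fl n a b st| ≤ wabs fl n a b st := abs_wdot_le_wabs fl n a b st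
    _ ≤ u ^ (st.1 + st.2) * (1 + u) ^ 2 * adotp n a b := wabs_le h hu n a b st
    _ = (1 + u) ^ 2 * u ^ (st.1 + st.2) * adotp n a b := by ring

/-- THEOREM 2.1, sharp form (Algorithm 2.1 at the `(i, j)` entry, before passing to `|A||B|`): with the
kept products `Ĝ_{st}` (`s + t ≤ p − 1`) satisfying (2.1) and summed in precision `u_high`
(`|Θ_{st}| ≤ γ^{high}_{p²−1}`),
`|Ĉ − AB|_{ij} ≤ (2u^p + u^{2p} + (1+u)² Σ_{dropped} u^{s+t}) (|A||B|)_{ij}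
  + γ^{high}_{n+p²−1} Σ_{kept} (|A_s||B_t|)_{ij}`. [cite: FasiEtAl2023, §2 Theorem 2.1] -/
theorem theorem21_core (h : RoundsRel u fl) (hu : 0 ≤ u) (huh : 0 ≤ uh) {n p : ℕ}
    (hN : ((n + (p * p - 1) : ℕ) : K) * uh < 1) (a b : ℕ → K) {G Θ : ℕ × ℕ → K} {C : K}
    (hG : ∀ st ∈ pairsKept p, |G st - wdot fl n a b st| ≤ gamma uh n * wabs fl n a b st)
    (hΘ : ∀ st ∈ pairsKept p, |Θ st| ≤ gamma uh (p * p - 1))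
    (hC : C = ∑ st ∈ pairsKept p, G st * (1 + Θ st)) :
    |C - dotp n a b| ≤ (2 * u ^ p + u ^ (2 * p) + (1 + u) ^ 2 * droppedWeight p u) * adotp n a b
      + gamma uh (n + (p * p - 1)) * ∑ st ∈ pairsKept p, wabs fl n a b st := by
  have hacc := acc_bound huh hN hG hΘ (fun st _ => abs_wdot_le_wabs fl n a b st)
  have hconv : |∑ l ∈ range n, (a l * resid fl (b l) p + resid fl (a l) p * b l
      - resid fl (a l) p * resid fl (b l) p)| ≤ (2 * u ^ p + u ^ (2 * p)) * adotp n a b := by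
    unfold adotp; rw [mul_sum]
    exact (abs_sum_le_sum_abs _ _).trans (sum_le_sum fun _ _ => abs_conv_le h hu _ _ _)
  have hdrop := abs_sum_dropped_le h hu n p a b
  rw [hC, dotp_expansion fl n p a b, sum_pairsAll_eq_add p]
  set A := ∑ st ∈ pairsKept p, G st * (1 + Θ st)
  set Sk := ∑ st ∈ pairsKept p, wdot fl n a b st
  set Sd := ∑ st ∈ pairsDropped p, wdot fl n a b st
  set V := ∑ l ∈ range n, (a l * resid fl (b l) p + resid fl (a l) p * b l
      - resid fl (a l) p * resid fl (b l) p)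
  have e : A - (Sk + Sd + V) = (A - Sk) + (-(Sd + V)) := by ring
  rw [e]
  calc |(A - Sk) + (-(Sd + V))| ≤ |A - Sk| + |-(Sd + V)| := abs_add_le _ _
    _ = |A - Sk| + |Sd + V| := by rw [abs_neg]
    _ ≤ |A - Sk| + (|Sd| + |V|) := by linarith [abs_add_le Sd V]
    _ ≤ _ := by linarith

/-- THEOREM 2.1 / EQ. (2.5) (Algorithm 2.1, the `|A||B|` form of the bound at the `(i, j)` entry):
`|Ĉ − AB|_{ij} ≤ (2u^p + u^{2p} + (1+u)²·Σ_{i=1}^{p−1}(p−i)u^{p+i−1}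
   + γ^{high}_{n+p²−1}(1+u)²·Σ_{k<p}(k+1)u^k) (|A||B|)_{ij}`
with the two weights in closed form by `droppedWeight_eq` / `keptWeight_eq`. This is the bound the
printed (2.5) abbreviates (its first line keeps these sums, its second line is (2.6) below).
[cite: FasiEtAl2023, §2 Theorem 2.1 eq. (2.5)] -/
theorem theorem21 (h : RoundsRel u fl) (hu : 0 ≤ u) (huh : 0 ≤ uh) {n p : ℕ}
    (hN : ((n + (p * p - 1) : ℕ) : K) * uh < 1) (a b : ℕ → K) {G Θ : ℕ × ℕ → K} {C : K}
    (hG : ∀ st ∈ pairsKept p, |G st - wdot fl n a b st| ≤ gamma uh n * wabs fl n a b st)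
    (hΘ : ∀ st ∈ pairsKept p, |Θ st| ≤ gamma uh (p * p - 1))
    (hC : C = ∑ st ∈ pairsKept p, G st * (1 + Θ st)) :
    |C - dotp n a b| ≤ (2 * u ^ p + u ^ (2 * p) + (1 + u) ^ 2 * droppedWeight p u
      + gamma uh (n + (p * p - 1)) * (1 + u) ^ 2 * keptWeight p u) * adotp n a b := by
  have hcore := theorem21_core h hu huh hN a b hG hΘ hC
  have hk : ∑ st ∈ pairsKept p, wabs fl n a b st ≤ (1 + u) ^ 2 * keptWeight p u * adotp n a b := by
    unfold keptWeight; rw [mul_sum, sum_mul]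
    exact sum_le_sum fun st _ => (wabs_le h hu n a b st).trans_eq (by ring)
  have hγ : 0 ≤ gamma uh (n + (p * p - 1)) := gamma_nonneg huh hN
  have := mul_le_mul_of_nonneg_left hk hγ
  linarith

/-! ## §2, eq. (2.6): the first-order form, with an explicit remainder -/

omit [LinearOrder K] [IsStrictOrderedRing K] in
/-- `(1 − u)² Σ_{k<p}(k+1)u^k = 1 − (p+1)u^p + p u^{p+1}`. [cite: FasiEtAl2023, §2 eq. (2.6)] -/
theorem one_sub_sq_mul_keptWeight (p : ℕ) (u : K) :
    (1 - u) ^ 2 * keptWeight p u = 1 - ((p : K) + 1) * u ^ p + (p : K) * u ^ (p + 1) := by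
  rw [keptWeight_eq]
  induction p with
  | zero => simp
  | succ q ih => rw [sum_range_succ, mul_add, ih]; push_cast; ring

/-- `(1 + u)² Σ_{kept} u^{s+t} ≤ 1 + 16u` for `0 ≤ u ≤ 1/2` (the `γ`-term of (2.5) is `γ(1 + O(u))`).
[cite: FasiEtAl2023, §2 eq. (2.6)] -/
theorem keptWeight_firstOrder (hu : 0 ≤ u) (hu2 : 2 * u ≤ 1) (p : ℕ) :
    (1 + u) ^ 2 * keptWeight p u ≤ 1 + 16 * u := by
  have hT : (1 - u) ^ 2 * keptWeight p u ≤ 1 := by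
    rw [one_sub_sq_mul_keptWeight]
    have : (p : K) * u ^ (p + 1) ≤ ((p : K) + 1) * u ^ p := by
      rw [pow_succ]
      have hp : (0 : K) ≤ p := Nat.cast_nonneg p
      have hup : 0 ≤ u ^ p := pow_nonneg hu p
      nlinarith [mul_nonneg hp hup, mul_le_mul_of_nonneg_left (show u ≤ 1 by linarith) (mul_nonneg hp hup)]
    linarith
  have hpos : 0 < (1 - u) ^ 2 := pow_pos (by linarith) 2
  have key : (1 - u) ^ 2 * (1 + 16 * u) - (1 + u) ^ 2 = 4 * u * ((1 - 2 * u) * (3 - 2 * u)) := by ring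
  have hf : 0 ≤ 4 * u * ((1 - 2 * u) * (3 - 2 * u)) :=
    mul_nonneg (by linarith) (mul_nonneg (by linarith) (by linarith))
  have h1 : (1 - u) ^ 2 * ((1 + u) ^ 2 * keptWeight p u) ≤ (1 - u) ^ 2 * (1 + 16 * u) := by
    calc (1 - u) ^ 2 * ((1 + u) ^ 2 * keptWeight p u) = (1 + u) ^ 2 * ((1 - u) ^ 2 * keptWeight p u) := by
          ring
      _ ≤ (1 + u) ^ 2 * 1 := mul_le_mul_of_nonneg_left hT (sq_nonneg _)
      _ ≤ (1 - u) ^ 2 * (1 + 16 * u) := by linarith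
  exact le_of_mul_le_mul_left h1 hpos

/-- `(1 + u)² Σ_{dropped} u^{s+t} ≤ (p − 1)u^p + 7(p − 1)u^{p+1}` for `0 ≤ u ≤ 1/2`, `p ≥ 1` (the leading
term `(p − 1)u_low^p` of the truncation error, "i = 1" in the print). [cite: FasiEtAl2023, §2 eq. (2.6)] -/
theorem droppedWeight_firstOrder (hu : 0 ≤ u) (hu2 : 2 * u ≤ 1) {p : ℕ} (hp : 1 ≤ p) :
    (1 + u) ^ 2 * droppedWeight p u ≤ ((p : K) - 1) * u ^ p + 7 * ((p : K) - 1) * u ^ (p + 1) := by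
  rw [droppedWeight_eq]
  obtain ⟨q, rfl⟩ : ∃ q, p = q + 1 := ⟨p - 1, by omega⟩
  rcases q with _ | q
  · simp
  · -- p = q + 2
    simp only [show q + 1 + 1 - 1 = q + 1 from rfl]
    rw [sum_range_succ']
    simp only [Nat.sub_zero, add_zero]
    set v := u ^ (q + 1 + 1) with hv
    have hv0 : 0 ≤ v := pow_nonneg hu _
    have hS : ∑ k ∈ range q, u ^ k ≤ 2 := by
      have hg := geom_sum_mul u q
      have hq0 : 0 ≤ u ^ q := pow_nonneg hu q
      have hS0 : 0 ≤ ∑ k ∈ range q, u ^ k := sum_nonneg fun k _ => pow_nonneg hu k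
      nlinarith [mul_nonneg hS0 hu]
    set R := ∑ k ∈ range q, ((q + 1 - (k + 1) : ℕ) : K) * u ^ (q + 1 + 1 + (k + 1)) with hR
    have hR0 : 0 ≤ R := sum_nonneg fun _ _ => mul_nonneg (Nat.cast_nonneg _) (pow_nonneg hu _)
    have hR1 : R ≤ 2 * (q : K) * (u * v) := by
      have hterm : ∀ k ∈ range q, ((q + 1 - (k + 1) : ℕ) : K) * u ^ (q + 1 + 1 + (k + 1))
          ≤ (q : K) * (u * v) * u ^ k := by
        intro k _
        have hc : ((q + 1 - (k + 1) : ℕ) : K) ≤ q := by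
          have : q + 1 - (k + 1) ≤ q := by omega
          exact_mod_cast this
        have he : u ^ (q + 1 + 1 + (k + 1)) = (u * v) * u ^ k := by rw [hv]; ring
        rw [he]
        calc ((q + 1 - (k + 1) : ℕ) : K) * ((u * v) * u ^ k) ≤ (q : K) * ((u * v) * u ^ k) :=
              mul_le_mul_of_nonneg_right hc (mul_nonneg (mul_nonneg hu hv0) (pow_nonneg hu k))
          _ = (q : K) * (u * v) * u ^ k := by ring
      calc R ≤ ∑ k ∈ range q, (q : K) * (u * v) * u ^ k := sum_le_sum hterm
        _ = (q : K) * (u * v) * ∑ k ∈ range q, u ^ k := by rw [mul_sum]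
        _ ≤ (q : K) * (u * v) * 2 :=
            mul_le_mul_of_nonneg_left hS (mul_nonneg (Nat.cast_nonneg q) (mul_nonneg hu hv0))
        _ = 2 * (q : K) * (u * v) := by ring
    have hq : (0 : K) ≤ q := Nat.cast_nonneg q
    have hcast : ((q + 1 : ℕ) : K) = (q : K) + 1 := by push_cast; ring
    have hp1 : (((q + 1 + 1 : ℕ) : K) - 1) = (q : K) + 1 := by push_cast; ring
    have hpow : u ^ (q + 1 + 1 + 1) = u * v := by rw [hv]; ring
    rw [hcast, hp1, hpow]
    have t1 : (1 + u) ^ 2 ≤ 9 / 4 := by nlinarith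
    have t2 : (1 + u) ^ 2 * R ≤ 9 / 4 * (2 * (q : K) * (u * v)) := mul_le_mul t1 hR1 hR0 (by norm_num)
    have t4 : (2 * u + u ^ 2) * (((q : K) + 1) * v) ≤ (5 / 2 * u) * (((q : K) + 1) * v) :=
      mul_le_mul_of_nonneg_right (by nlinarith) (by positivity)
    have huv : 0 ≤ u * v := mul_nonneg hu hv0
    nlinarith [mul_nonneg hq huv, t2, t4]

/-- EQ. (2.6), with an explicit remainder: for `0 ≤ u_low ≤ 1/2` and `p ≥ 1` the bound of Theorem 2.1 is
`|Ĉ − AB|_{ij} ≤ ((p+1)u_low^p + γ^{high}_{n+p²−1} + R)(|A||B|)_{ij}` with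
`0 ≤ R ≤ (7p − 6)u_low^{p+1} + 16 γ^{high}_{n+p²−1} u_low`, i.e. "to first order
`|Ĉ − AB| ≤ ((p+1)u_low^p + γ^{high}_{n+p²−1})|A||B|`". The remainder constants `7p − 6` and `16` are
this file's (the print writes `O(u_{p+1} + γ^{high}_{n+p²−1} u_low)`).
[cite: FasiEtAl2023, §2 Theorem 2.1 eq. (2.6)] -/
theorem theorem21_firstOrder (h : RoundsRel u fl) (hu : 0 ≤ u) (hu2 : 2 * u ≤ 1) (huh : 0 ≤ uh)
    {n p : ℕ} (hp : 1 ≤ p) (hN : ((n + (p * p - 1) : ℕ) : K) * uh < 1) (a b : ℕ → K)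
    {G Θ : ℕ × ℕ → K} {C : K}
    (hG : ∀ st ∈ pairsKept p, |G st - wdot fl n a b st| ≤ gamma uh n * wabs fl n a b st)
    (hΘ : ∀ st ∈ pairsKept p, |Θ st| ≤ gamma uh (p * p - 1))
    (hC : C = ∑ st ∈ pairsKept p, G st * (1 + Θ st)) :
    |C - dotp n a b| ≤ (((p : K) + 1) * u ^ p + gamma uh (n + (p * p - 1))
      + ((7 * (p : K) - 6) * u ^ (p + 1) + 16 * gamma uh (n + (p * p - 1)) * u)) * adotp n a b := by
  have h21 := theorem21 h hu huh hN a b hG hΘ hC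
  have hγ : 0 ≤ gamma uh (n + (p * p - 1)) := gamma_nonneg huh hN
  have W1 := droppedWeight_firstOrder hu hu2 hp
  have W2 := mul_le_mul_of_nonneg_left (keptWeight_firstOrder hu hu2 p) hγ
  have W3 : u ^ (2 * p) ≤ u ^ (p + 1) := pow_le_pow_of_le_one hu (by linarith) (by omega)
  refine h21.trans (mul_le_mul_of_nonneg_right ?_ (adotp_nonneg n a b))
  have e : gamma uh (n + (p * p - 1)) * (1 + u) ^ 2 * keptWeight p u
      = gamma uh (n + (p * p - 1)) * ((1 + u) ^ 2 * keptWeight p u) := by ring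
  rw [e]
  linarith

/-- THEOREM 2.1 for whole matrices: the entrywise statement `|Ĉ − C| ≤ …` for `A ∈ ℝ^{m×n}`,
`B ∈ ℝ^{n×q}` (rows `i : ι`, columns `j : ρ`), each entry computed by Algorithm 2.1 as in
`theorem21`. [cite: FasiEtAl2023, §2 Theorem 2.1 eq. (2.5)] -/
theorem theorem21_matrix {ι ρ : Type*} (h : RoundsRel u fl) (hu : 0 ≤ u) (huh : 0 ≤ uh) {n p : ℕ}
    (hN : ((n + (p * p - 1) : ℕ) : K) * uh < 1) (A : ι → ℕ → K) (B : ℕ → ρ → K)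
    {G Θ : ι → ρ → ℕ × ℕ → K} {C : ι → ρ → K}
    (hG : ∀ i j, ∀ st ∈ pairsKept p, |G i j st - wdot fl n (A i) (fun l => B l j) st|
      ≤ gamma uh n * wabs fl n (A i) (fun l => B l j) st)
    (hΘ : ∀ i j, ∀ st ∈ pairsKept p, |Θ i j st| ≤ gamma uh (p * p - 1))
    (hC : ∀ i j, C i j = ∑ st ∈ pairsKept p, G i j st * (1 + Θ i j st)) (i : ι) (j : ρ) :
    |C i j - dotp n (A i) (fun l => B l j)|
      ≤ (2 * u ^ p + u ^ (2 * p) + (1 + u) ^ 2 * droppedWeight p u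
        + gamma uh (n + (p * p - 1)) * (1 + u) ^ 2 * keptWeight p u)
          * adotp n (A i) (fun l => B l j) :=
  theorem21 h hu huh hN (A i) (fun l => B l j) (hG i j) (hΘ i j) (hC i j)

end products

/-! ## §2, Table 2.1 and the two-word weights -/

omit [LinearOrder K] [IsStrictOrderedRing K] in
/-- `p = 2` (double-word: double-fp16, double-bfloat16, double-fp32): kept weight `1 + 2u`, dropped
weight `u²`; so (2.5) reads `(3u² + 3u³ + u⁴ + γ^{high}_{n+3}(1+u)²(1+2u))|A||B|`.
[cite: FasiEtAl2023, §2 Table 2.1] -/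
theorem weights_two (u : K) : keptWeight 2 u = 1 + 2 * u ∧ droppedWeight 2 u = u ^ 2 := by
  constructor
  · rw [keptWeight_eq, sum_range_succ, sum_range_succ, sum_range_zero]; push_cast; ring
  · rw [droppedWeight_eq, show 2 - 1 = 1 from rfl, sum_range_succ, sum_range_zero]; push_cast; ring

omit [LinearOrder K] [IsStrictOrderedRing K] in
/-- `p = 3` (triple-word: triple-bfloat16, triple-fp16): kept weight `1 + 2u + 3u²`, dropped weight
`2u³ + u⁴`. [cite: FasiEtAl2023, §2 Table 2.1] -/
theorem weights_three (u : K) :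
    keptWeight 3 u = 1 + 2 * u + 3 * u ^ 2 ∧ droppedWeight 3 u = 2 * u ^ 3 + u ^ 4 := by
  constructor
  · rw [keptWeight_eq, sum_range_succ, sum_range_succ, sum_range_succ, sum_range_zero]
    push_cast; ring
  · rw [droppedWeight_eq, show 3 - 1 = 2 from rfl, sum_range_succ, sum_range_succ, sum_range_zero]
    push_cast; ring

/-- TABLE 2.1, the arithmetic of its five rows `(u_low, u_high, p) ↦ u_low^p + γ^{high}_{n+p²−1}`:
double-fp16 `(2⁻¹¹)² = 2⁻²²`, `n + 3`; double-bfloat16 `(2⁻⁸)² = 2⁻¹⁶`, `n + 3`; triple-bfloat16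
`(2⁻⁸)³ = 2⁻²⁴`, `n + 8`; triple-fp16 `(2⁻¹¹)³ = 2⁻³³`, `n + 8`; double-fp32 `(2⁻²⁴)² = 2⁻⁴⁸`, `n + 3`
(the table reports the leading power `u_low^p`, dropping the factor `p + 1` of (2.6)).
[cite: FasiEtAl2023, §2 Table 2.1] -/
theorem table21 :
    ((2 : ℚ)⁻¹ ^ 11) ^ 2 = 2⁻¹ ^ 22 ∧ ((2 : ℚ)⁻¹ ^ 8) ^ 2 = 2⁻¹ ^ 16 ∧ ((2 : ℚ)⁻¹ ^ 8) ^ 3 = 2⁻¹ ^ 24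
      ∧ ((2 : ℚ)⁻¹ ^ 11) ^ 3 = 2⁻¹ ^ 33 ∧ ((2 : ℚ)⁻¹ ^ 24) ^ 2 = 2⁻¹ ^ 48
      ∧ (2 * 2 - 1 = 3 ∧ 3 * 3 - 1 = 8) := by
  norm_num

/-! ## §4.4: FABsum for the first-order product (Algorithms 4.2–4.4) and the `2²²` remark -/

/-- FABsum-v1 (Algorithm 4.2): intra-block sums of `b` terms with backward error `γ_b` (tensor cores,
fp32 accumulation) and the `m = n/b` inter-block additions in fp32 (`γ_m`, same unit roundoff `v`)
give an overall backward error `γ_b + γ_m + γ_bγ_m ≤ γ_{b+m}` — "the worst-case error bound is reduced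
from `n × 2⁻²⁴` to `(b + n/b) × 2⁻²⁴`" to first order. An instance of [BlanchardHighamMary2020,
Theorem 3.1] (`theorem31_isBackwardSum`). [cite: FasiEtAl2023, §4.4 Algorithm 4.2] -/
theorem fabsum_v1 {β κ : Type*} (t : Finset β) (sk : β → Finset κ) (x : β → κ → K) (ŝ : β → K)
    {v T : K} (hv : 0 ≤ v) {b m : ℕ} (hbm : ((b + m : ℕ) : K) * v < 1)
    (hloc : ∀ c ∈ t, IsBackwardSum (sk c) (x c) (ŝ c) (gamma v b))
    (htot : IsBackwardSum t ŝ T (gamma v m)) :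
    IsBackwardSum (t.sigma sk) (fun q => x q.1 q.2) T (gamma v (b + m)) :=
  (theorem31_isBackwardSum t sk x ŝ hloc htot).mono (gamma_add_gamma_add_mul_le hv hbm)

/-- FABsum-v2 (Algorithm 4.3): intra-block backward error `γ^{(32)}_b` (unit roundoff `v`), inter-block
additions in fp64 (`γ^{(64)}_m`, unit roundoff `w`): overall backward error
`γ^{(32)}_b + γ^{(64)}_m + γ^{(32)}_bγ^{(64)}_m` — "`b × 2⁻²⁴ + n/b × 2⁻⁵³`" to first order (the final
rounding `C ← fl₃₂(C)` of line 7 is not included). [cite: FasiEtAl2023, §4.4 Algorithm 4.3] -/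
theorem fabsum_v2 {β κ : Type*} (t : Finset β) (sk : β → Finset κ) (x : β → κ → K) (ŝ : β → K)
    {v w T : K} {b m : ℕ}
    (hloc : ∀ c ∈ t, IsBackwardSum (sk c) (x c) (ŝ c) (gamma v b))
    (htot : IsBackwardSum t ŝ T (gamma w m)) :
    IsBackwardSum (t.sigma sk) (fun q => x q.1 q.2) T
      (gamma v b + gamma w m + gamma v b * gamma w m) :=
  theorem31_isBackwardSum t sk x ŝ hloc htot

/-- The `2²²` threshold of §4.4 (why Algorithm 4.4 applies FABsum to `A₁B₁` only): the cross products
`A₁B₂`, `A₂B₁` contribute `n × 2⁻¹¹ × 2⁻²⁴`, which exceeds the probabilistic `√n × 2⁻²⁴` of the fp32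
product exactly when `n > 2²²` ("≈ 4 × 10⁶"): for real `n ≥ 0`, `n·2⁻¹¹ ≤ √n ↔ n ≤ 2²²`.
[cite: FasiEtAl2023, §4.4 (paragraph before Algorithm 4.4)] -/
theorem crossTerm_threshold (n : ℝ) (hn : 0 ≤ n) : n / 2 ^ 11 ≤ Real.sqrt n ↔ n ≤ 2 ^ 22 := by
  rw [Real.le_sqrt (by positivity) hn]
  rcases hn.eq_or_lt with h | h
  · subst h; norm_num
  · constructor <;> intro h' <;> nlinarith [h, h']

end Literature.ComputerArithmetic.FasiHighamLopezMaryMikaitis2023
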